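import Summits.ABC.StewartYu.PadicTwoSetup
import Summits.ABC.StewartYu.PadicTwistCoreBound
import HarnessLib

/-!
# Cell abc-stewartyu, W80Two: the core bound of the `2`-adic machine — statement and the case `d = 0`

`Summits/ABC/StewartYu/PadicTwoCoreBound.lean` — cell `abc-stewartyu` (seat p3; route
`PadicPrimesW80TwoThirds`, crux `W80Two` stmt-ABC-19486; one `def … : Prop` + theorems, no named fact).
The `p = 2` twin of p2's `TwistSetup.TwistCoreBound` / `coreBound_of_d_zero` (`PadicTwistEngine.lean`,
`PadicTwistCoreBound.lean`): there is no twist at `p = 2` (no class price, `ℓ := 1`), the generators are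
INTEGERS `≡ 1 (mod 8)` with the CUBE-Kummer condition (the `q = 3` descent), the floors are `1 ≤ Vⱼ`,
`1 ≤ W`:

* `TwoSetup.TwoCoreBound C` — for every `2`-adic set-up `S` (lit's `TwoSetup`) with integer, multiplicatively
  independent, cube-Kummer generators, heights `h(αⱼ) ≤ Vⱼ`, `h(θ) ≤ V_θ`, `1 ≤ V ≤ Vmax`,
  `log max(3,|b|) ≤ W`, `1 ≤ W`:
  `‖Λ₀‖₂ > exp(−C(d+1) · (∏ Vⱼ · V_θ) · (W + log 2Vmax) · log 2Vmax)`;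
* `TwoSetup.norm_Λ₀_eq_of_d_zero` (`‖Λ₀‖₂ = ‖1 − θ‖₂` for `d = 0`) and
  `TwoSetup.coreBound_of_d_zero` — the case `d = 0` by Liouville alone (`‖1 − θ‖₂ ≥ 1/(2H(θ))`,
  p2's `TwistSetup.norm_one_sub_pow_ge` at `G = 1`; `3 ≤ C 1`).

Everything is [folklore] in the architecture of [Yu1990, Theorem 2.1] / [Waldschmidt1980, Prop. 3.8].

## References
* [Yu1990] K. Yu, *Linear forms in p-adic logarithms II*, Compositio Math. 74 (1990), Theorem 2.1,
  §1.1 (`p = 2`) and Lemma 1.3.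
* [Waldschmidt1980] M. Waldschmidt, Acta Arith. 37 (1980), Prop. 3.8 (p. 263).
-/

noncomputable section

open NormedSpace Finset IsUltrametricDist Height
open Literature.NumberTheory.Transcendental

namespace Summit.ABC.StewartYu

namespace TwoSetup

/-- **The core bound of the `2`-adic machine** (no twist, `ℓ := 1`, integer cube-Kummer generators):
`‖Λ₀‖₂ > exp(−C(d+1) · (∏ Vⱼ · V_θ) · (W + log 2V_max) · log(2V_max))`.
[cite: Yu1990, Theorem 2.1] [cite: Waldschmidt1980, Prop. 3.8 (p. 263)] -/
def TwoCoreBound (C : ℕ → ℝ) : Prop :=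
  ∀ (S : TwoSetup) (V : Fin S.d → ℝ) (Vθ Vmax W : ℝ),
    (∀ i, ∃ a : ℤ, S.toQ.all i = a) →
    (∀ κ : Fin (S.d + 1) → ℕ, (∃ j, ¬ 3 ∣ κ j) → ∀ γ : ℚ, ∏ j, S.toQ.all j ^ κ j ≠ γ ^ 3) →
    (∀ μ : Fin (S.d + 1) → ℤ, ∏ i, S.toQ.all i ^ μ i = 1 → μ = 0) →
    (∀ j, logHeight₁ (S.α j) ≤ V j) → logHeight₁ S.θ ≤ Vθ →
    (∀ j, 1 ≤ V j) → 1 ≤ Vθ → (∀ j, V j ≤ Vmax) → Vθ ≤ Vmax →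
    (∀ j, Real.log (max 3 (|S.b j| : ℝ)) ≤ W) → Real.log (max 3 (|S.bθ| : ℝ)) ≤ W → 1 ≤ W →
    Real.exp (-(C (S.d + 1) * ((∏ j, V j) * Vθ) * (W + Real.log (2 * Vmax)) * Real.log (2 * Vmax))) <
      ‖S.Λ₀‖

/-! ### The case `d = 0` (one logarithm): Liouville alone -/

/-- For `d = 0`, `Λ₀ = −log₂ θ`, so `‖Λ₀‖₂ = ‖1 − θ‖₂`. [cite: Yu1990, §1.1] -/
theorem norm_Λ₀_eq_of_d_zero (S : TwoSetup) (hd : S.d = 0) : ‖S.Λ₀‖ = ‖1 - (S.θ : ℚ_[2])‖ := by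
  have h0 : ∑ j : Fin S.d, (S.frame.β j : ℚ_[2]) * S.lg j = 0 := by
    have : IsEmpty (Fin S.d) := by rw [hd]; infer_instance
    exact Finset.sum_eq_zero fun j _ => (IsEmpty.false j).elim
  unfold TwoSetup.Λ₀
  rw [h0, zero_sub, norm_neg]
  unfold lgθ
  rw [S.norm_lgAll_eq]
  unfold ω SetupQ.all
  rw [Fin.snoc_last]

/-- **The core bound for `d = 0`** (one logarithm): for `3 ≤ C 1` the inequality of `TwoCoreBound` holds
by Liouville alone — `θ ≠ 1` (`θ ≡ 1 (mod 8)` has `ord₂(θ − 1) ≥ 3`), `‖1 − θ‖₂ ≥ 1/(2H(θ))` and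
`U = C·V_θ·(W + log 2Vmax)·log 2Vmax > h(θ) + log 2` (`V_θ, W ≥ 1`). [cite: Yu1990, §1.1 and Lemma 1.3] -/
theorem coreBound_of_d_zero (S : TwoSetup) (hd : S.d = 0) {C : ℕ → ℝ} (hC1 : 3 ≤ C 1)
    (V : Fin S.d → ℝ) (Vθ Vmax W : ℝ) (hVθ : logHeight₁ S.θ ≤ Vθ) (hVθ1 : 1 ≤ Vθ) (hVθm : Vθ ≤ Vmax)
    (hW1 : 1 ≤ W) :
    Real.exp (-(C (S.d + 1) * ((∏ j, V j) * Vθ) * (W + Real.log (2 * Vmax)) * Real.log (2 * Vmax))) <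
      ‖S.Λ₀‖ := by
  have hV1 : ∏ j : Fin S.d, V j = 1 := by
    have : IsEmpty (Fin S.d) := by rw [hd]; infer_instance
    exact Finset.prod_eq_one fun j _ => (IsEmpty.false j).elim
  rw [hV1, one_mul, S.norm_Λ₀_eq_of_d_zero hd]
  simp only [hd, zero_add]
  -- numerics
  have hlog2 := Real.log_two_gt_d9
  have hl2V : Real.log 2 ≤ Real.log (2 * Vmax) := Real.log_le_log two_pos (by linarith)
  have hHpos : 0 < CW77.hgt S.θ := lt_of_lt_of_le one_pos (CW77.one_le_hgt _)
  have hH : Real.log (CW77.hgt S.θ) = logHeight₁ S.θ := by rw [Rat.logHeight₁_eq_log_max]; rfl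
  have hlogH0 : 0 ≤ logHeight₁ S.θ := by rw [← hH]; exact Real.log_nonneg (CW77.one_le_hgt _)
  -- `θ ≠ 1`
  have hθ1 : S.θ ^ 1 ≠ 1 := by rw [pow_one]; exact ne_one_of_three_le S.hθ
  have hLiou := TwistSetup.norm_one_sub_pow_ge (p := 2) S.θ 1 hθ1
  rw [pow_one, pow_one] at hLiou
  have hU : logHeight₁ S.θ + Real.log 2 < C 1 * Vθ * (W + Real.log (2 * Vmax)) * Real.log (2 * Vmax) := by
    have h4 : C 1 * Vθ * (W + Real.log (2 * Vmax)) * Real.log (2 * Vmax) ≥ 3 * Vθ * (1 + 0.69) * 0.69 := by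
      have : (0.69 : ℝ) ≤ Real.log (2 * Vmax) := by linarith
      have : (1 + 0.69 : ℝ) ≤ W + Real.log (2 * Vmax) := by linarith
      have hC0 : (0 : ℝ) ≤ C 1 := by linarith
      gcongr
    have := Real.log_two_lt_d9
    nlinarith
  calc Real.exp (-(C 1 * Vθ * (W + Real.log (2 * Vmax)) * Real.log (2 * Vmax)))
      < Real.exp (-(logHeight₁ S.θ + Real.log 2)) := by rw [Real.exp_lt_exp]; linarith
    _ = 1 / (2 * CW77.hgt S.θ) := by
        rw [Real.exp_neg, ← hH, Real.exp_add, Real.exp_log hHpos, Real.exp_log two_pos, one_div,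
          mul_comm]
    _ ≤ ‖1 - (S.θ : ℚ_[2])‖ := hLiou

end TwoSetup

end Summit.ABC.StewartYu

end
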